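import Literature.Analysis.FluidPDE.CKNTenThirdsInterpolation
import Literature.Analysis.FluidPDE.NSSuitableESS
import HarnessLib

/-!
# The multiplicative inequality `L^∞L² ∩ L²H¹ ⊂ L^{10/3}` on a cylinder `(a, b) × B₁`

Analysis/FluidPDE support file (theorems only). For a field `u` on the cylinder
`W = (a, b) × B₁ ⊆ ℝ × ℝ³` with sliced energy `esssup_{a<t<b} ∫_{B₁} |u(t)|² ≤ A` and a weak spatial
gradient `G` on `W` with dissipation `D = ∫∫_W |G|²`, the "known multiplicative inequality"
(Seregin, *Lecture notes on regularity theory for the Navier–Stokes equations* (2014), App. B.4,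
(B.4.2): `∫₀^{T₀}∫_{B(n)} |v|^{10/3} ≤ c (sup_t ∫_{B(n)} |v|²)^{2/3} ∫₀^{T₀}∫_{B(n)} (|∇v|² + n⁻²|v|²)`;
Caffarelli–Kohn–Nirenberg 1982, (2.9)–(2.10)) bounds

  `∫∫_W |u|^{10/3} ≤ C₀ A^{2/3} ((b − a) A + D)`

with an absolute constant `C₀` (`exists_setLIntegral_rpow_ten_thirds_le`). This is the uniform
higher-integrability bound used in every compactness argument for suitable weak solutions
(strong `L³` convergence of the velocities from strong `L²` convergence; uniform integrability of
the cubic and pressure–velocity terms of the local energy inequality), in particular in the limit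
step of Bradshaw–Tsai 2019, §4.3 ("hence also in `L^{10/3}(0,T;L^{10/3}(B₁))`", arXiv p. 12) —
facts `bradshawTsai2019_cylinderCompactness`, `bradshawTsai2019_limitDatum`.

The tree has this bound on backward and centred *parabolic* cylinders `Q_r(z)` in terms of the
CKN quantities (`exists_lintegral_tenThirds_backward_le`, `CKNTenThirdsInterpolation.lean`, for
the `ε`-regularity theory); here it is stated on cylinders `(a, b) × B₁` of arbitrary time length
with the sliced energy bound and the dissipation as explicit hypotheses — the shape in which the
compactness arguments on `(0, T) × B₁` consume it. Proof: as there (and as the interpolation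
inequality `C(r) ≤ C₀ (A + E)^{3/2}` of `CKNInterpolationEstimate.lean`): for a.e. `t` the slice
`u(t)` has the weak derivative `G(t)` on `B₁` (`HasWeakSpatialGradientOn.ae_hasWeakFDerivOn_slice`),
Sobolev on the unit ball (`exists_eLpNorm_six_le_unitBall`:
`‖u(t)‖_{L⁶(B₁)} ≤ C_S (‖u(t)‖_{L²} + ‖G(t)‖_{L²})`) and the Lebesgue interpolation
(`lintegral_rpow_tenThirds_le_Lp_interpolation`) give `∫_{B₁} |u(t)|^{10/3} ≤ A^{2/3} (2C_S)² (a(t) + e(t))`,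
which is integrated in time (Tonelli).

## References

* G. Seregin, *Lecture notes on regularity theory for the Navier–Stokes equations* (2014), App.
  B.4, (B.4.2) [Seregin2014Notes].
* L. Caffarelli, R. Kohn, L. Nirenberg, CPAM 35 (1982), §2, (2.9)–(2.10)
  [CaffarelliKohnNirenberg1982].
* Z. Bradshaw, T.-P. Tsai, Analysis & PDE 12 (2019) = arXiv:1801.08060, §4.3 [BradshawTsai2019].
-/

noncomputable section

open MeasureTheory Set Function Filter TopologicalSpace Metric Module
open scoped NNReal ENNReal Topology

namespace Literature.Analysis.FluidPDE

/-! ### The inequality on `(a, b) × B₁` -/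

section Cylinder

/-- **The multiplicative inequality `L^∞L² ∩ L²H¹ ⊂ L^{10/3}` on a cylinder `(a, b) × B₁`**
(Seregin 2014, App. B.4, (B.4.2); Caffarelli–Kohn–Nirenberg 1982, (2.9)–(2.10)): there is an
absolute constant `C₀` such that for every field `u : ℝ → EuclideanSpace ℝ (Fin 3) → EuclideanSpace ℝ (Fin 3)` with a weak spatial gradient
`G` on the open cylinder `(a, b) × B₁` (`timeCylinder unitBall a b`) and every `A ≠ ∞` with
`∫_{B₁} |u(t)|² ≤ A` for a.e. `t ∈ (a, b)`,
`∫∫_{(a,b)×B₁} |u|^{10/3} ≤ C₀ A^{2/3} ((b − a) A + ∫∫_{(a,b)×B₁} |G|²)`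
(Frobenius density `|G|² = ∑ᵢ ‖G eᵢ‖²`). If the dissipation is infinite the right-hand side is
`∞` (for `A ≠ 0`). [cite: Seregin2014Notes, App. B.4 (B.4.2)] -/
theorem exists_setLIntegral_rpow_ten_thirds_le :
    ∃ C₀ : ℝ≥0, ∀ (a b : ℝ) (u : ℝ → EuclideanSpace ℝ (Fin 3) → EuclideanSpace ℝ (Fin 3)) (G : ℝ → EuclideanSpace ℝ (Fin 3) → EuclideanSpace ℝ (Fin 3) →L[ℝ] EuclideanSpace ℝ (Fin 3)) (A : ℝ≥0∞),
      HasWeakSpatialGradientOn (timeCylinder unitBall a b) u G → A ≠ ∞ →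
      (∀ᵐ t ∂(volume.restrict (Ioo a b)), ∫⁻ x in ball (0 : EuclideanSpace ℝ (Fin 3)) 1, ‖u t x‖ₑ ^ 2 ≤ A) →
      ∫⁻ z in Ioo a b ×ˢ ball (0 : EuclideanSpace ℝ (Fin 3)) 1, ‖u z.1 z.2‖ₑ ^ (10 / 3 : ℝ) ≤
        C₀ * A ^ (2 / 3 : ℝ) * (ENNReal.ofReal (b - a) * A +
          ∫⁻ z in Ioo a b ×ˢ ball (0 : EuclideanSpace ℝ (Fin 3)) 1, ENNReal.ofReal (frobeniusNormSq (G z.1 z.2))) := by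
  obtain ⟨CS, hCS⟩ := exists_eLpNorm_six_le_unitBall
  refine ⟨(2 * CS) ^ 2, fun a b u G A h hA hbound => ?_⟩
  -- notation
  set B : Set (EuclideanSpace ℝ (Fin 3)) := ball 0 1 with hB
  set I : Set ℝ := Ioo a b with hI
  set α : ℝ → ℝ≥0∞ := fun t => ∫⁻ x in B, ‖u t x‖ₑ ^ 2 with hα
  set e : ℝ → ℝ≥0∞ := fun t => ∫⁻ x in B, ENNReal.ofReal (frobeniusNormSq (G t x)) with he
  set c : ℝ → ℝ≥0∞ := fun t => ∫⁻ x in B, ‖u t x‖ₑ ^ (10 / 3 : ℝ) with hc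
  have hW : ((timeCylinder unitBall a b : Opens (ℝ × EuclideanSpace ℝ (Fin 3))) : Set (ℝ × EuclideanSpace ℝ (Fin 3))) = I ×ˢ B := rfl
  -- measurability on the cylinder
  have hum : AEStronglyMeasurable (uncurry u) (volume.restrict (I ×ˢ B)) :=
    (h.locallyIntegrableOn.mono_set hW.symm.subset).aestronglyMeasurable
  have hGm : AEStronglyMeasurable (uncurry G) (volume.restrict (I ×ˢ B)) :=
    (h.locallyIntegrableOn_grad.mono_set hW.symm.subset).aestronglyMeasurable
  have hprod : (volume.restrict (I ×ˢ B) : Measure (ℝ × EuclideanSpace ℝ (Fin 3))) =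
      (volume.restrict I).prod (volume.restrict B) := by
    rw [Measure.volume_eq_prod, Measure.prod_restrict]
  have hum103 : AEMeasurable (fun q : ℝ × EuclideanSpace ℝ (Fin 3) => ‖u q.1 q.2‖ₑ ^ (10 / 3 : ℝ))
      ((volume.restrict I).prod (volume.restrict B)) := by
    rw [← hprod]; exact (hum.enorm.pow_const _)
  have hum2 : AEMeasurable (fun q : ℝ × EuclideanSpace ℝ (Fin 3) => ‖u q.1 q.2‖ₑ ^ (2 : ℕ))
      ((volume.restrict I).prod (volume.restrict B)) := by
    rw [← hprod]; exact (hum.enorm.pow_const 2)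
  have hGm2 : AEMeasurable (fun q : ℝ × EuclideanSpace ℝ (Fin 3) =>
      ENNReal.ofReal (frobeniusNormSq (G q.1 q.2))) ((volume.restrict I).prod (volume.restrict B)) := by
    rw [← hprod]
    exact (continuous_frobeniusNormSq'.comp_aestronglyMeasurable hGm).aemeasurable.ennreal_ofReal
  -- Tonelli
  have hDeq : ∫⁻ z in I ×ˢ B, ENNReal.ofReal (frobeniusNormSq (G z.1 z.2)) = ∫⁻ t in I, e t := by
    rw [Measure.volume_eq_prod, setLIntegral_prod _ (by rwa [← Measure.prod_restrict])]
  have hCeq : ∫⁻ z in I ×ˢ B, ‖u z.1 z.2‖ₑ ^ (10 / 3 : ℝ) = ∫⁻ t in I, c t := by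
    rw [Measure.volume_eq_prod, setLIntegral_prod _ (by rwa [← Measure.prod_restrict])]
  have hαm : AEMeasurable α (volume.restrict I) := hum2.lintegral_prod_right'
  have hem : AEMeasurable e (volume.restrict I) := hGm2.lintegral_prod_right'
  -- a.e. in time: energy bound and weak derivative of the slice
  have h3 : ∀ᵐ t ∂(volume.restrict I), FunctionSpaces.HasWeakFDerivOn
      (⟨B, isOpen_ball⟩ : Opens (EuclideanSpace ℝ (Fin 3))) volume (u t) (G t) :=
    HasWeakSpatialGradientOn.ae_hasWeakFDerivOn_slice (Ω := (⟨B, isOpen_ball⟩ : Opens (EuclideanSpace ℝ (Fin 3)))) h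
  -- the pointwise-in-time estimate `c(t) ≤ A^{2/3} (2 C_S)² (α(t) + e(t))`
  set K : ℝ≥0∞ := A ^ (2 / 3 : ℝ) * ((2 * CS : ℝ≥0) : ℝ≥0∞) ^ (2 : ℕ) with hK
  have hKtop : K ≠ ∞ :=
    ENNReal.mul_ne_top (ENNReal.rpow_ne_top_of_nonneg (by norm_num) hA)
      (ENNReal.pow_ne_top ENNReal.coe_ne_top)
  have hpt : ∀ᵐ t ∂(volume.restrict I), c t ≤ K * (α t + e t) := by
    filter_upwards [hbound, h3] with t hat hwt
    have hat' : α t ≠ ∞ := ne_top_of_le_ne_top hA hat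
    have hutm : AEStronglyMeasurable (u t) (volume.restrict B) :=
      hwt.locallyIntegrableOn.aestronglyMeasurable
    -- `‖u t‖_{L²(B)} = α(t)^{1/2}`
    have hL2 : eLpNorm (u t) 2 (volume.restrict B) = α t ^ (1 / 2 : ℝ) := by
      rw [eLpNorm_eq_lintegral_rpow_enorm_toReal two_ne_zero ENNReal.ofNat_ne_top,
        ENNReal.toReal_ofNat, hα]
      simp only [one_div]
      congr 1
      refine lintegral_congr fun x => ?_
      rw [show (2 : ℝ) = ((2 : ℕ) : ℝ) by norm_num, ENNReal.rpow_natCast]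
    have hL2' : eLpNorm (u t) 2 (volume.restrict B) ≠ ∞ := by
      rw [hL2]; exact ENNReal.rpow_ne_top_of_nonneg (by norm_num) hat'
    -- Sobolev on the slice
    have hS : eLpNorm (u t) 6 (volume.restrict B) ≤
        CS * (α t ^ (1 / 2 : ℝ) + e t ^ (1 / 2 : ℝ)) := by
      have := hCS (u t) (G t) hwt hL2'
      rwa [hL2] at this
    have hS2 : eLpNorm (u t) 6 (volume.restrict B) ≤
        ((2 * CS : ℝ≥0) : ℝ≥0∞) * (α t + e t) ^ (1 / 2 : ℝ) := by
      refine hS.trans ?_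
      have h1' : α t ^ (1 / 2 : ℝ) ≤ (α t + e t) ^ (1 / 2 : ℝ) :=
        ENNReal.rpow_le_rpow le_self_add (by norm_num)
      have h2' : e t ^ (1 / 2 : ℝ) ≤ (α t + e t) ^ (1 / 2 : ℝ) :=
        ENNReal.rpow_le_rpow le_add_self (by norm_num)
      calc (CS : ℝ≥0∞) * (α t ^ (1 / 2 : ℝ) + e t ^ (1 / 2 : ℝ))
          ≤ CS * ((α t + e t) ^ (1 / 2 : ℝ) + (α t + e t) ^ (1 / 2 : ℝ)) := by gcongr
        _ = ((2 * CS : ℝ≥0) : ℝ≥0∞) * (α t + e t) ^ (1 / 2 : ℝ) := by push_cast; ring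
    -- `(∫ |u t|⁶)^{1/3} = ‖u t‖_{L⁶}²`
    have hL6 : (∫⁻ x in B, ‖u t x‖ₑ ^ (6 : ℝ)) ^ (1 / 3 : ℝ) =
        eLpNorm (u t) 6 (volume.restrict B) ^ (2 : ℕ) := by
      rw [eLpNorm_eq_lintegral_rpow_enorm_toReal (by norm_num) ENNReal.ofNat_ne_top,
        ENNReal.toReal_ofNat, ← ENNReal.rpow_natCast, ← ENNReal.rpow_mul]
      norm_num
    -- `(∫ |u t|²)^{2/3} ≤ A^{2/3}`
    have hα23 : (∫⁻ x in B, ‖u t x‖ₑ ^ (2 : ℕ)) ^ (2 / 3 : ℝ) ≤ A ^ (2 / 3 : ℝ) :=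
      ENNReal.rpow_le_rpow hat (by norm_num)
    -- Hölder in space
    have hH := lintegral_rpow_tenThirds_le_Lp_interpolation (volume.restrict B) hutm.enorm
    calc c t ≤ (∫⁻ x in B, ‖u t x‖ₑ ^ (2 : ℕ)) ^ (2 / 3 : ℝ) *
          (∫⁻ x in B, ‖u t x‖ₑ ^ (6 : ℝ)) ^ (1 / 3 : ℝ) := hH
      _ = (∫⁻ x in B, ‖u t x‖ₑ ^ (2 : ℕ)) ^ (2 / 3 : ℝ) *
          eLpNorm (u t) 6 (volume.restrict B) ^ (2 : ℕ) := by rw [hL6]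
      _ ≤ A ^ (2 / 3 : ℝ) * (((2 * CS : ℝ≥0) : ℝ≥0∞) * (α t + e t) ^ (1 / 2 : ℝ)) ^ (2 : ℕ) := by
          gcongr
      _ = K * (α t + e t) := by
          rw [hK, mul_pow, ← ENNReal.rpow_natCast ((α t + e t) ^ (1 / 2 : ℝ)), ← ENNReal.rpow_mul]
          norm_num
          ring
  -- integrate in time
  have hint_α : ∫⁻ t in I, α t ≤ ENNReal.ofReal (b - a) * A := by
    calc ∫⁻ t in I, α t ≤ ∫⁻ _ in I, A := lintegral_mono_ae hbound
      _ = A * (volume.restrict I) univ := lintegral_const A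
      _ = ENNReal.ofReal (b - a) * A := by
          rw [Measure.restrict_apply_univ, hI, Real.volume_Ioo, mul_comm]
  calc ∫⁻ z in I ×ˢ B, ‖u z.1 z.2‖ₑ ^ (10 / 3 : ℝ) = ∫⁻ t in I, c t := hCeq
    _ ≤ ∫⁻ t in I, K * (α t + e t) := lintegral_mono_ae hpt
    _ = K * ((∫⁻ t in I, α t) + ∫⁻ t in I, e t) := by
        rw [lintegral_const_mul' _ _ hKtop, lintegral_add_left' hαm]
    _ ≤ K * (ENNReal.ofReal (b - a) * A +
          ∫⁻ z in I ×ˢ B, ENNReal.ofReal (frobeniusNormSq (G z.1 z.2))) := by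
        rw [hDeq]
        gcongr
    _ = (((2 * CS) ^ 2 : ℝ≥0) : ℝ≥0∞) * A ^ (2 / 3 : ℝ) * (ENNReal.ofReal (b - a) * A +
          ∫⁻ z in I ×ˢ B, ENNReal.ofReal (frobeniusNormSq (G z.1 z.2))) := by
        rw [hK, ENNReal.coe_pow, mul_comm (A ^ (2 / 3 : ℝ))]

end Cylinder

end Literature.Analysis.FluidPDE

end
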